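import Literature.Analysis.FluidPDE.SverakLandauConformalCalc
import Summits.NavierStokesRegularity.NavierStokesRegularity.Theorems.EulerZoomLiouvillePowerGaugeEulerLiouvilleEnergySaturationCutoff

/-!
# Crux `EulerZoomLiouville.PowerGaugeEulerLiouville` (stmt-NavierStokesRegularity-19832), line `logtime-breathers`:
# the CLASSICAL local energy equality and pressure–Poisson equation of a generalised profile equation

Width seat `ns-ezl-w4` (breather rigidity, file I: pointwise tools, integrals against gradients, pressure–Poisson).  Let `V : ℝ³ → ℝ³`, `P : ℝ³ → ℝ` be `C¹`, `div V = 0`, and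
suppose the GENERALISED PROFILE EQUATION
`α V + β (y·∇)V + (V·∇)V + ∇P = 0`                                                      (PE_{α,β})
holds pointwise (`(y·∇)V(y) = DV(y)[y]`).  The power clock of rate `γ` is `(α, β) = (1 − γ, γ)`
(Constantin–Ignatova–Vicol (3.3)); the LOG-TIME BREATHER `u(τ,y) = e^{cτ} V(e^{−cτ}y)` is `(α, β) = (c, −c)`
(`ClockRigidity.profile_identity` with `θ = ℓ = e^{cτ}`), which NO power clock realises.  By whole-space
integration by parts (`Literature.Analysis.FluidPDE.WholeSpaceIBP`):

* `pressure_poisson` — `∫ P Δθ = −∫ D²θ(V, V)` for every `θ ∈ C²_c` (pair (PE) with `∇θ`: the linear terms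
  drop out because `V` and `(y·∇)V − V`… are divergence free, `∫⟪(V·∇)V, ∇θ⟫ = −∫D²θ(V,V)`);
* `local_energy_equality` — `(2α − 3β) ∫ σ|V|² = ∫ (|V|² + 2P)⟪V, ∇σ⟫ + β ∫ |V|²⟪y, ∇σ⟫` for every
  `σ ∈ C¹_c` (pair (PE) with `σV`); for `(1−γ, γ)` this is the classical case of
  `ProfileEnergy.profile_local_energy_equality`, for the breather it reads `5c N_σ + c X_σ = F_σ`;
* `hasDerivAt_rpow_mul_cutoffEnergy`, `rpow_mul_cutoffEnergy_sub_eq` — the scale ODE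
  `(L^κ N_σ(L))' = β⁻¹ L^{κ−1} F_σ(L)` (`κβ = 2α − 3β`, `N_σ(L) = ∫σ(L⁻¹y)|V|²`) and its integrated form,
  the `κ = 2ρ − 1` case being the tree's `EnergySaturation.hasDerivAt_normEnergy_of_energyEquality`;
  for the breather `κ = −5`.

WHAT THIS IS NOT: not NS regularity, not the crux — calculus for the breather-rigidity member of line
`logtime-breathers` (T2/T3); `--supports` stmt-19832. [folklore]
-/

noncomputable section

set_option linter.dupNamespace false

open MeasureTheory Set Filter Topology Metric Function TopologicalSpace
open scoped ENNReal NNReal RealInnerProductSpace ContDiff Laplacian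

namespace Summit.NavierStokesRegularity.NavierStokesRegularity.Theorems.PowerGaugeEulerLiouville

open Literature.Analysis Literature.Analysis.FunctionSpaces Literature.Analysis.FluidPDE

namespace ClassicalProfile

variable {V : EuclideanSpace ℝ (Fin 3) → EuclideanSpace ℝ (Fin 3)} {P σ θ : EuclideanSpace ℝ (Fin 3) → ℝ}

/-! ## Pointwise tools -/

/-- The gradient of a `C²` function is `C¹`. [folklore] -/
theorem contDiff_one_gradient (hθ : ContDiff ℝ 2 θ) : ContDiff ℝ 1 (gradient θ) :=
  (InnerProductSpace.toDual ℝ (EuclideanSpace ℝ (Fin 3))).symm.contDiff.comp (hθ.fderiv_right (m := 1) le_rfl)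

/-- The gradient of a compactly supported function is compactly supported. [folklore] -/
theorem hasCompactSupport_gradient (hθc : HasCompactSupport θ) : HasCompactSupport (gradient θ) :=
  (hθc.fderiv (𝕜 := ℝ)).comp_left (g := (InnerProductSpace.toDual ℝ (EuclideanSpace ℝ (Fin 3))).symm)
    (map_zero _)

/-- `⟪a, D(∇θ)(x)[y]⟫ = D²θ(x)[y][a]` for `θ ∈ C²`. [folklore] -/
theorem inner_fderiv_gradient (hθ : ContDiff ℝ 2 θ) (x a y : EuclideanSpace ℝ (Fin 3)) :
    ⟪a, fderiv ℝ (gradient θ) x y⟫ = fderiv ℝ (fderiv ℝ θ) x y a := by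
  have hgd : DifferentiableAt ℝ (gradient θ) x := (contDiff_one_gradient hθ).differentiable one_ne_zero x
  have hfd : DifferentiableAt ℝ (fderiv ℝ θ) x :=
    ((hθ.fderiv_right (m := 1) le_rfl).differentiable one_ne_zero) x
  have h1 : ⟪a, fderiv ℝ (gradient θ) x y⟫ = fderiv ℝ (fun t => ⟪a, gradient θ t⟫) x y := by
    rw [fderiv_inner_apply ℝ (differentiableAt_const _) hgd, fderiv_fun_const]
    simp
  have h2 : (fun t => ⟪a, gradient θ t⟫) = fun t => (fderiv ℝ θ t) a := by
    funext t
    rw [real_inner_comm, FluidPDE.inner_gradient_left]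
  rw [h1, h2, fderiv_clm_apply hfd (differentiableAt_const a), fderiv_fun_const]
  simp

/-- `D²θ(x)[v][x] = D(y ↦ Dθ(y)[y])(x)[v] − Dθ(x)[v]` for `θ ∈ C²` (Leibniz). [folklore] -/
theorem fderiv_fderiv_apply_self (hθ : ContDiff ℝ 2 θ) (x v : EuclideanSpace ℝ (Fin 3)) :
    fderiv ℝ (fderiv ℝ θ) x v x = fderiv ℝ (fun y => fderiv ℝ θ y y) x v - fderiv ℝ θ x v := by
  have hfd : DifferentiableAt ℝ (fderiv ℝ θ) x :=
    ((hθ.fderiv_right (m := 1) le_rfl).differentiable one_ne_zero) x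
  rw [fderiv_clm_apply (u := fun y => y) hfd differentiableAt_id]
  simp

/-- `⟪W, ∇σ⟫` is integrable for `W` continuous and `σ ∈ C¹_c`. [folklore] -/
theorem integrable_inner_gradient_of_continuous {W : EuclideanSpace ℝ (Fin 3) → EuclideanSpace ℝ (Fin 3)}
    (hW : Continuous W) (hσ : ContDiff ℝ 1 σ) (hσc : HasCompactSupport σ) :
    Integrable (fun x => ⟪W x, gradient σ x⟫) volume := by
  refine (hW.inner (continuous_gradient_of_contDiff hσ)).integrable_of_hasCompactSupport ?_
  refine (hσc.fderiv (𝕜 := ℝ)).mono fun x hx => ?_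
  rw [mem_support] at hx ⊢
  contrapose! hx
  rw [real_inner_comm, FluidPDE.inner_gradient_left, hx, _root_.zero_apply]

/-- `f ⟪W, ∇σ⟫` is integrable for `f, W` continuous and `σ ∈ C¹_c`. [folklore] -/
theorem integrable_mul_inner_gradient_of_continuous {f : EuclideanSpace ℝ (Fin 3) → ℝ}
    {W : EuclideanSpace ℝ (Fin 3) → EuclideanSpace ℝ (Fin 3)}
    (hf : Continuous f) (hW : Continuous W) (hσ : ContDiff ℝ 1 σ) (hσc : HasCompactSupport σ) :
    Integrable (fun x => f x * ⟪W x, gradient σ x⟫) volume := by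
  refine ((hf.mul (hW.inner (continuous_gradient_of_contDiff hσ))).integrable_of_hasCompactSupport ?_)
  refine (hσc.fderiv (𝕜 := ℝ)).mono fun x hx => ?_
  rw [mem_support] at hx ⊢
  contrapose! hx
  show f x * ⟪W x, gradient σ x⟫ = 0
  rw [real_inner_comm, FluidPDE.inner_gradient_left, hx, _root_.zero_apply, mul_zero]

/-! ## Integrals against gradients -/

/-- `∫ ⟪V, ∇θ⟫ = 0` for `V ∈ C¹` divergence free and `θ ∈ C¹_c`. [folklore] -/
theorem integral_inner_gradient_eq_zero (hV : ContDiff ℝ 1 V) (hdiv : VectorCalculus.IsDivFree V)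
    (hθ : ContDiff ℝ 1 θ) (hθc : HasCompactSupport θ) :
    ∫ x, ⟪V x, gradient θ x⟫ = 0 := by
  have h := integral_mul_divergence_add_eq_zero_left hθ hV hθc
  have h0 : ∫ x, θ x * VectorCalculus.divergence V x = 0 := by
    simp [hdiv _]
  linarith

/-- `∫ ⟪(V·∇)V, ∇θ⟫ = −∫ D²θ(V, V)` for `V ∈ C¹` divergence free and `θ ∈ C²_c`. [folklore] -/
theorem integral_inner_convect_gradient (hV : ContDiff ℝ 1 V) (hdiv : VectorCalculus.IsDivFree V)
    (hθ : ContDiff ℝ 2 θ) (hθc : HasCompactSupport θ) :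
    ∫ x, ⟪fderiv ℝ V x (V x), gradient θ x⟫ = -∫ x, fderiv ℝ (fderiv ℝ θ) x (V x) (V x) := by
  have h := integral_inner_convect_add_eq_zero hV hV (contDiff_one_gradient hθ) (hasCompactSupport_gradient hθc)
  simp only [convect_apply, hdiv _, zero_mul, integral_zero, add_zero] at h
  have h2 : ∫ x, ⟪V x, fderiv ℝ (gradient θ) x (V x)⟫ = ∫ x, fderiv ℝ (fderiv ℝ θ) x (V x) (V x) :=
    integral_congr_ae (Eventually.of_forall fun x => inner_fderiv_gradient hθ x (V x) (V x))
  linarith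

/-- `∫ ⟪(y·∇)V, ∇θ⟫ = 0` for `V ∈ C¹` divergence free and `θ ∈ C²_c` (the field `(y·∇)V − V`… : pair the
trilinear identity for `u = id` with Schwarz' symmetry `D²θ(x)[x][V] = D²θ(x)[V][x]`). [folklore] -/
theorem integral_inner_fderiv_self_gradient_eq_zero (hV : ContDiff ℝ 1 V) (hdiv : VectorCalculus.IsDivFree V)
    (hθ : ContDiff ℝ 2 θ) (hθc : HasCompactSupport θ) :
    ∫ x, ⟪fderiv ℝ V x x, gradient θ x⟫ = 0 := by
  have hid : ContDiff ℝ 1 (fun y : EuclideanSpace ℝ (Fin 3) => y) := contDiff_id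
  have h := integral_inner_convect_add_eq_zero hid hV (contDiff_one_gradient hθ) (hasCompactSupport_gradient hθc)
  simp only [convect_apply, Sverak2011.divergence_id_three] at h
  -- the auxiliary scalar `φ(y) = Dθ(y)[y]`
  have hθ1 : ContDiff ℝ 1 θ := hθ.of_le (by norm_cast)
  have hφ : ContDiff ℝ 1 (fun y => fderiv ℝ θ y y) := (hθ.fderiv_right (m := 1) le_rfl).clm_apply contDiff_id
  have hφc : HasCompactSupport (fun y => fderiv ℝ θ y y) :=
    (hθc.fderiv (𝕜 := ℝ)).mono fun x hx => by
      intro h0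
      exact hx (by simp [h0])
  have hsymm : ∀ x, fderiv ℝ (fderiv ℝ θ) x x (V x) = fderiv ℝ (fderiv ℝ θ) x (V x) x := fun x =>
    (hθ.contDiffAt.isSymmSndFDerivAt (by simp)).eq x (V x)
  have h2 : ∫ x, ⟪V x, fderiv ℝ (gradient θ) x x⟫ =
      (∫ x, ⟪V x, gradient (fun y => fderiv ℝ θ y y) x⟫) - ∫ x, ⟪V x, gradient θ x⟫ := by
    rw [← integral_sub]
    · refine integral_congr_ae (Eventually.of_forall fun x => ?_)
      show ⟪V x, fderiv ℝ (gradient θ) x x⟫ = ⟪V x, gradient (fun y => fderiv ℝ θ y y) x⟫ - ⟪V x, gradient θ x⟫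
      rw [inner_fderiv_gradient hθ, hsymm, fderiv_fderiv_apply_self hθ, real_inner_comm,
        FluidPDE.inner_gradient_left, real_inner_comm, FluidPDE.inner_gradient_left]
    · exact integrable_inner_gradient_of_continuous hV.continuous hφ hφc
    · exact integrable_inner_gradient_of_continuous hV.continuous hθ1 hθc
  rw [h2, integral_inner_gradient_eq_zero hV hdiv hφ hφc, integral_inner_gradient_eq_zero hV hdiv hθ1 hθc] at h
  have h3 : ∫ x, (3 : ℝ) * ⟪V x, gradient θ x⟫ = 0 := by
    rw [integral_const_mul, integral_inner_gradient_eq_zero hV hdiv hθ1 hθc, mul_zero]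
  linarith

/-- `∫ ⟪∇P, ∇θ⟫ = −∫ P Δθ` for `P ∈ C¹`, `θ ∈ C²_c`. [folklore] -/
theorem integral_inner_gradient_gradient (hP : ContDiff ℝ 1 P) (hθ : ContDiff ℝ 2 θ) (hθc : HasCompactSupport θ) :
    ∫ x, ⟪gradient P x, gradient θ x⟫ = -∫ x, P x * (Δ θ) x := by
  rw [integral_inner_gradient_eq_neg_integral_mul_divergence hP (contDiff_one_gradient hθ)
    (hasCompactSupport_gradient hθc)]
  congr 1
  refine integral_congr_ae (Eventually.of_forall fun x => ?_)
  show P x * VectorCalculus.divergence (gradient θ) x = P x * (Δ θ) x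
  rw [divergence_gradient hθ]

/-! ## The pressure–Poisson equation of a classical generalised profile -/

/-- **Pressure–Poisson equation, weak form, of the generalised profile equation.**  If `V, P ∈ C¹`,
`div V = 0` and `α V + β (y·∇)V + (V·∇)V + ∇P = 0` pointwise, then `∫ P Δθ = −∫ D²θ(V,V)` for every
`θ ∈ C²_c` — i.e. `−ΔP = ∂ᵢ∂ⱼ(VᵢVⱼ)` in distributions. [folklore] -/
theorem pressure_poisson (hV : ContDiff ℝ 1 V) (hP : ContDiff ℝ 1 P) (hdiv : VectorCalculus.IsDivFree V)
    {α β : ℝ} (heq : ∀ x, α • V x + β • fderiv ℝ V x x + fderiv ℝ V x (V x) + gradient P x = 0)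
    (hθ : ContDiff ℝ 2 θ) (hθc : HasCompactSupport θ) :
    ∫ x, P x * (Δ θ) x = -∫ x, fderiv ℝ (fderiv ℝ θ) x (V x) (V x) := by
  have hθ1 : ContDiff ℝ 1 θ := hθ.of_le (by norm_cast)
  -- pointwise pairing of the equation with `∇θ`
  have hpt : ∀ x, ⟪fderiv ℝ V x (V x), gradient θ x⟫ + ⟪gradient P x, gradient θ x⟫ =
      -(α * ⟪V x, gradient θ x⟫) - β * ⟪fderiv ℝ V x x, gradient θ x⟫ := by
    intro x
    have h := congrArg (fun w => ⟪w, gradient θ x⟫) (heq x)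
    simp only [inner_add_left, inner_smul_left, inner_zero_left, RCLike.conj_to_real] at h
    linarith
  have hiC : Integrable (fun x => ⟪fderiv ℝ V x (V x), gradient θ x⟫) volume :=
    integrable_inner_gradient_of_continuous ((hV.continuous_fderiv one_ne_zero).clm_apply hV.continuous) hθ1 hθc
  have hiP : Integrable (fun x => ⟪gradient P x, gradient θ x⟫) volume :=
    integrable_inner_gradient_of_continuous (continuous_gradient_of_contDiff hP) hθ1 hθc
  have hiV : Integrable (fun x => ⟪V x, gradient θ x⟫) volume :=
    integrable_inner_gradient_of_continuous hV.continuous hθ1 hθc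
  have hiS : Integrable (fun x => ⟪fderiv ℝ V x x, gradient θ x⟫) volume :=
    integrable_inner_gradient_of_continuous ((hV.continuous_fderiv one_ne_zero).clm_apply continuous_id) hθ1 hθc
  have hint : (∫ x, ⟪fderiv ℝ V x (V x), gradient θ x⟫) + ∫ x, ⟪gradient P x, gradient θ x⟫ =
      -(α * ∫ x, ⟪V x, gradient θ x⟫) - β * ∫ x, ⟪fderiv ℝ V x x, gradient θ x⟫ := by
    rw [← integral_add hiC hiP, ← integral_const_mul, ← integral_const_mul, ← integral_neg, ← integral_sub]
    · exact integral_congr_ae (Eventually.of_forall fun x => by simp only [hpt x])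
    · exact (hiV.const_mul α).neg
    · exact hiS.const_mul β
  rw [integral_inner_convect_gradient hV hdiv hθ hθc, integral_inner_gradient_gradient hP hθ hθc,
    integral_inner_gradient_eq_zero hV hdiv hθ1 hθc, integral_inner_fderiv_self_gradient_eq_zero hV hdiv hθ hθc] at hint
  linarith

end ClassicalProfile

end Summit.NavierStokesRegularity.NavierStokesRegularity.Theorems.PowerGaugeEulerLiouville

end
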